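import Literature.MathematicalPhysics.QuantumFieldTheory.Balaban1983to89.Node00.Record12NumericsFamilyDict

/-!
# NODE 00 (YM-PLAN Track A) — STAGE 12, THE z-WITNESS EDITION «Z1» OF THE D-MAKERS: `stage8OfNumericsDZ` ∕ `stage12OfNumericsDZ` ∕ `theta12OfFamilyLZ` WITH THE PER-RUN
# FLUCTUATION LETTERS `Efl`, `logz` (the fluctuation constants `E_k` and `log z_k` of [III] (1.15) ∕ [V] (0.15)) AS ARGUMENTS — OPEN LETTERS — INSTEAD OF THE CLOSED `0`

Cell `ym-nodeO-ideate`, DEFINER seat `ym-nodeO-def-1` (gen 9), PEN NAMED BY THE PLAN OF RECORD (plan g86 `[YMPLAN-G86-ANSWER-218]`, pub-ymgap bus l.38303, 2026-08-28T13:13Z) on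
director-ym g10 №218 «NEW FLAG №9 · K1-FACE DOOR WITNESS COUPLING-BLIND» (bus l.38254).  `--kind definition --supports stmt-QuantumFields-20541` (Literature Node00 lane;
count-neutral).  APPEND-ONLY discipline: NOTHING landed is edited — this is a NEW module importing `Record12NumericsFamilyDict` (seat K0a g3) and every landed maker ∕ witness is the
`(0, 0)` INSTANCE of the Z edition BY `rfl` (§3), so no downstream `rfl` face re-keys.  [I] = [Balaban1987RG1], [III] = [Balaban1988Convergent], [IV] = [Balaban1989LargeFieldI],
[V] = [Balaban1989LargeFieldII].

WHY (the located defect, not an improvement).  dag-n24-c g11 LOCATED-WITNESS-COUPLING-BLIND (bus l.38101) + dag-n13-w3 g5 path (C) `k1R9Body_false_of_logz_zero_Efl_zero` + ref-H g24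
A2-ADDENDUM (kernel `rfl`: `Record12NumericsFamilyDict` :113–114 put `Efl := fun _ _ => 0`, `logz := fun _ _ => 0` in `stage8OfNumericsD`, inherited by `stage12OfNumericsD` →
`theta12OfFamilyL` → `theta13OfNumerics` → `theta13LiveOfNumerics` → `theta13OfThm1CCM(W)` and preserved by `ofHistoryBlind`): the all-numerics witness family of record is
COUPLING-BLIND — its fluctuation letters vanish identically — so it can never be the (existential) `θ` of K1⁹'s conclusion once (C) lands; every door-keyed K1 closer AT that witness is
vacuous-in-regime (director-ym №218 (1)(a)–(b)).  WHAT MUST MOVE = THE WITNESS (№218 (3)): a «…Z» edition of the family carrying print's `z` ∕ `E` as LETTERS.  THIS FILE is its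
Stage-8∕12 half: the ROWS THAT CHANGE are EXACTLY `Efl` and `logz` (field types `Record7` :41 ∕ :43, `B12.RunParams → ℕ → ℝ`); every other row (`γ, res, ν, rep, εbg, Vβ, ιβ, ρ8, bV,
v₀`; `τ9, ppSel, A₁, ζ, ScorrLaw, cβ, s2, Rz, Zt`) is `stage8OfNumericsD` ∕ `stage12OfNumericsD`'s VERBATIM.  Stage-12 ADMISSIBILITY reads no fluctuation letter, so
`admissible_stage12OfNumericsDZ_iff ↔ d.Admissible ∧ n.Pos` is the D-maker's statement verbatim (§2).  The Stage-13 half (`theta13OfNumericsZ`, `theta13LiveOfNumericsZ`,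
`theta13OfThm1CCMZ`, `theta13OfThm1CCMWZ`, bridges, faces) is the sibling «Z2» `Node00/Record13NumericsOfThm1CCMZ.lean`.

WHAT THIS FILE DOES NOT DO (by design; director-ym №126 precedent «state the consumer before pinning a value»): it pins NO closed value of `E_k` or `log z_k` — they are OPEN
LETTERS of the witness; NODE N13's theorem delivers the pair with the (1.15) [III] ∕ (0.15) [V] identities and bounds, and a K1⁹ prover instantiates the existential `θ` at the delivered
pair; a closed-form `z` letter per [V] (0.15) typed as print would be a separate Literature letter.

CONTENTS.  §1 `stage8OfNumericsDZ` · `stage12OfNumericsDZ` · rfl views (`_Efl`, `_logz` NEW; `_toStage3Params`, `_ℓ₆`, `_toStage8Params`, `_ν`, `_γ`, `_τ9`, `_A₁`, `_s2`, `_ζ`, `_Rz`,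
`_Zt`, `_ppSel` re-issued by token-pass) · `isChartOfRecord_stage8OfNumericsDZ`; §2 `admissible_stage12OfNumericsDZ_iff` · `admissible_stage12OfNumericsDZ`; §3 BRIDGES (`rfl`):
`stage8OfNumericsD_eq_DZ` · `stage12OfNumericsD_eq_DZ` · `stage8OfNumerics_eq_DZ` · `stage12OfNumerics_eq_DZ`; §4 the family-block-size witness with letters `theta12OfFamilyLZ F N ε₀ ζ Rz Zt Efl
logz`, its rfl views, `theta12OfFamilyL_eq_LZ` (`rfl`), `admissible_theta12OfFamilyLZ`, `hasResidualsOfRecord_theta12OfFamilyLZ`, the row-N1 numerals (`kp_tree ∕ kp_n10 ∕ kp_large`).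

HONEST FRAMING.  A DEFINITION edition threading two open letters through the numerics makers; NOTHING of Bałaban's is asserted; no proviso is touched; no estimate; no value of
`E_k` ∕ `log z_k` pinned; K0⁷ stmt-QuantumFields-20541 NOT discharged and its registered texts untouched (HARD FREEZE logic: no re-cut); FLAG №9 is NOT closed by this file (it closes
per №218 (4): (C) ∧ the z-witness edition ∧ one door-keyed closer re-keyed at the z-witness with a referee PASS); no node count moves (typed 28∕28 · discharged 5∕27 (A 5∕28)).
One finite four-torus programme at fixed `ε = L^{−K}` — NOT the continuum limit on ℝ⁴, NOT infinite volume, NOT OS, NOT a mass gap, NOT the Clay problem; R4 = the CONDITIONAL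
finite-𝕋⁴ rung `BalabanLadder.UV` only.  No `sorry`, no `axiom`, no `instance`, no `notation`.
-/

noncomputable section

open MeasureTheory
open scoped Matrix.Norms.L2Operator

namespace Literature.MathematicalPhysics.QuantumFieldTheory.Balaban1983to89.Node00

open T4Continuum AveragingRT T4FiniteEpsInhabited FlowStep FlowStepRuns DagBinding T4DatumAssembly B4GaugeCovariance

/-! ## §1. The makers WITH THE FLUCTUATION LETTERS AS ARGUMENTS -/

section MakerDZ

variable (F : T4Family) (N : ℕ) [NeZero N]
variable (d : Stage3Params) (n : Stage12Numerics) (res : Residual₅ F N) (Efl logz : B12.RunParams → ℕ → ℝ)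

/-- **Stage-8 parameters FROM A DICTIONARY `d`, NUMERICS `n`, a Stage-5 residual `res` AND THE FLUCTUATION LETTERS `Efl`, `logz`** — `stage8OfNumericsD` with its two closed
rows `Efl := 0`, `logz := 0` replaced by the ARGUMENTS (the per-run fluctuation constants `E_k` and `log z_k` of (1.15) [III] ∕ (0.15) [V], read by `EOfRecord` at Stage 7);
every other row verbatim. [cite: Balaban1988Convergent, (1.15) p.249, (2.4)–(2.5) p.255; Balaban1989LargeFieldII, (0.15) p.360; Balaban1987RG1, (0.21) p.256 (parameter dictionary)] -/
def stage8OfNumericsDZ : Stage8Params F N :=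
  { stage8OfNumericsD F N d n res with
    Efl := Efl
    logz := logz }

/-- FACE (`rfl`): the Z-maker's fluctuation-energy letter IS the argument. [cite: Balaban1988Convergent, (1.15) p.249 (bookkeeping)] -/
theorem stage8OfNumericsDZ_Efl : (stage8OfNumericsDZ F N d n res Efl logz).Efl = Efl := rfl

/-- FACE (`rfl`): the Z-maker's `log z` letter IS the argument. [cite: Balaban1989LargeFieldII, (0.15) p.360 (bookkeeping)] -/
theorem stage8OfNumericsDZ_logz : (stage8OfNumericsDZ F N d n res Efl logz).logz = logz := rfl

/-- FACE (`rfl`): numerics row. [cite: Balaban1988Convergent, (2.4) p.255 (bookkeeping)] -/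
theorem stage8OfNumericsDZ_ν : (stage8OfNumericsDZ F N d n res Efl logz).ν = n.ν := rfl

/-- FACE (`rfl`): window row. [cite: Balaban1987RG1, Thm 1 p.259 (bookkeeping)] -/
theorem stage8OfNumericsDZ_γ : (stage8OfNumericsDZ F N d n res Efl logz).γ = n.γ := rfl

/-- FACE (`rfl`): residual row. [cite: Balaban1987RG1, (1.20)–(1.22) p.264 (bookkeeping)] -/
theorem stage8OfNumericsDZ_res : (stage8OfNumericsDZ F N d n res Efl logz).res = res := rfl

/-- FACE (`rfl`): base histories row `v₀ = 0`, verbatim. [cite: Balaban1989LargeFieldI, (0.2) p.176 (bookkeeping)] -/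
theorem stage8OfNumericsDZ_v₀ : (stage8OfNumericsDZ F N d n res Efl logz).v₀ = (stage8OfNumericsD F N d n res).v₀ := rfl

/-- The Z-maker carries the chart of record of 𝔰𝔲(N) (`c = 1`), verbatim. [cite: Balaban1989LargeFieldI, (0.2) p.176 (bookkeeping)] -/
theorem isChartOfRecord_stage8OfNumericsDZ : (stage8OfNumericsDZ F N d n res Efl logz).IsChartOfRecord 1 :=
  isSuChart_suChartMap N

variable (ζ : ZetaOfRecord F N n.ν n.τ9.M) (Rz : (K : ℕ) → Sect2.Residual (F.P K) (MatA N)) (Zt : (K : ℕ) → TkResidualW F N (FluctV N) K)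

/-- **Stage-12 parameters FROM A DICTIONARY, NUMERICS, a Stage-5 residual, the residual objects `ζ`, `Rz`, `Zt` AND THE FLUCTUATION LETTERS** — `stage12OfNumericsD` with `Efl`,
`logz` as arguments — the SAME literal as `stage12OfNumericsD` over `stage8OfNumericsDZ`; every other row verbatim. [cite: Balaban1988Convergent, (1.15) p.249, (2.21) p.258, (3.4) p.265, (3.16) p.268; Balaban1989LargeFieldII, (0.15) p.360; Balaban1989LargeFieldI, (0.3) p.176 (parameter dictionary)] -/
def stage12OfNumericsDZ : Stage12Params F N :=
  { stage8OfNumericsDZ F N d n res Efl logz with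
    τ9 := n.τ9
    ppSel := ppSelIdOfRecord F n.ν n.τ9.M
    A₁ := n.A₁
    ζ := ζ
    ScorrLaw := fun _ _ _ => True
    cβ := 1
    s2 := n.s2
    Rz := Rz
    Zt := Zt }

/-- FACE (`rfl`): `Efl`. [cite: Balaban1988Convergent, (1.15) p.249 (bookkeeping)] -/
theorem stage12OfNumericsDZ_Efl : (stage12OfNumericsDZ F N d n res Efl logz ζ Rz Zt).Efl = Efl := rfl

/-- FACE (`rfl`): `logz`. [cite: Balaban1989LargeFieldII, (0.15) p.360 (bookkeeping)] -/
theorem stage12OfNumericsDZ_logz : (stage12OfNumericsDZ F N d n res Efl logz ζ Rz Zt).logz = logz := rfl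

/-- FACE (`rfl`): the Stage-8 part IS the Stage-8 Z-maker. [cite: Balaban1987RG1, (0.21) p.256 (bookkeeping)] -/
theorem stage12OfNumericsDZ_toStage8Params : (stage12OfNumericsDZ F N d n res Efl logz ζ Rz Zt).toStage8Params = stage8OfNumericsDZ F N d n res Efl logz := rfl

/-- FACE (`rfl`): dictionary. [cite: Balaban1987RG1, (0.1) p.251 (bookkeeping)] -/
theorem stage12OfNumericsDZ_toStage3Params : (stage12OfNumericsDZ F N d n res Efl logz ζ Rz Zt).toStage3Params = d := rfl

/-- FACE (`rfl`): block letter `ℓ₆`. [cite: Balaban1987RG1, (0.1) p.251 (bookkeeping)] -/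
theorem stage12OfNumericsDZ_ℓ₆ : (stage12OfNumericsDZ F N d n res Efl logz ζ Rz Zt).ℓ₆ = d.ℓ₆ := rfl

/-- FACE (`rfl`): Stage-7 numerics. [cite: Balaban1988Convergent, (2.4) p.255 (bookkeeping)] -/
theorem stage12OfNumericsDZ_ν : (stage12OfNumericsDZ F N d n res Efl logz ζ Rz Zt).ν = n.ν := rfl

/-- FACE (`rfl`): window. [cite: Balaban1987RG1, Thm 1 p.259 (bookkeeping)] -/
theorem stage12OfNumericsDZ_γ : (stage12OfNumericsDZ F N d n res Efl logz ζ Rz Zt).γ = n.γ := rfl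

/-- FACE (`rfl`): tower numerics. [cite: Balaban1989LargeFieldI, (0.3) p.176 (bookkeeping)] -/
theorem stage12OfNumericsDZ_τ9 : (stage12OfNumericsDZ F N d n res Efl logz ζ Rz Zt).τ9 = n.τ9 := rfl

/-- FACE (`rfl`): `A₁`. [cite: Balaban1988Convergent, (3.16) p.268 (bookkeeping)] -/
theorem stage12OfNumericsDZ_A₁ : (stage12OfNumericsDZ F N d n res Efl logz ζ Rz Zt).A₁ = n.A₁ := rfl

/-- FACE (`rfl`): §2 numerics. [cite: Balaban1988Convergent, (2.28) p.259 (bookkeeping)] -/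
theorem stage12OfNumericsDZ_s2 : (stage12OfNumericsDZ F N d n res Efl logz ζ Rz Zt).s2 = n.s2 := rfl

/-- FACE (`rfl`): `ζ`. [cite: Balaban1988Convergent, (3.16) p.268 (bookkeeping)] -/
theorem stage12OfNumericsDZ_ζ : (stage12OfNumericsDZ F N d n res Efl logz ζ Rz Zt).ζ = ζ := rfl

/-- FACE (`rfl`): `Rz`. [cite: Balaban1988Convergent, (2.21) p.258 (bookkeeping)] -/
theorem stage12OfNumericsDZ_Rz : (stage12OfNumericsDZ F N d n res Efl logz ζ Rz Zt).Rz = Rz := rfl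

/-- FACE (`rfl`): `Zt`. [cite: Balaban1988Convergent, (3.20) p.269 (bookkeeping)] -/
theorem stage12OfNumericsDZ_Zt : (stage12OfNumericsDZ F N d n res Efl logz ζ Rz Zt).Zt = Zt := rfl

/-- FACE (`rfl`): the identity `p–p′` selector. [cite: Balaban1989LargeFieldI, (0.3) p.176 (bookkeeping)] -/
theorem stage12OfNumericsDZ_ppSel : (stage12OfNumericsDZ F N d n res Efl logz ζ Rz Zt).ppSel = ppSelIdOfRecord F n.ν n.τ9.M := rfl

/-- FACE (`rfl`): residual row. [cite: Balaban1987RG1, (1.20)–(1.22) p.264 (bookkeeping)] -/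
theorem stage12OfNumericsDZ_res : (stage12OfNumericsDZ F N d n res Efl logz ζ Rz Zt).res = res := rfl

/-! ## §2. Admissibility reads no fluctuation letter -/

/-- **STAGE-12 ADMISSIBILITY OF THE Z-MAKER ↔ the dictionary is Stage-1 admissible ∧ `n.Pos`** — letter-blind AND residual-blind (`admissible_stage12OfNumericsD_iff`'s statement
verbatim: no clause of `Stage12Params.Admissible` reads `Efl` or `logz`). [cite: Balaban1987RG1, (0.21) p.256, (1.12) p.262, (1.20)–(1.21) p.264; Balaban1988Convergent, (2.4) p.255, (2.10) p.256, (2.28) p.259, (2.34)–(2.39) p.261, (3.4) p.265 (bookkeeping)] -/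
theorem admissible_stage12OfNumericsDZ_iff :
    (stage12OfNumericsDZ F N d n res Efl logz ζ Rz Zt).Admissible F N ↔ d.toStage1Params.Admissible ∧ n.Pos := by
  constructor
  · rintro ⟨⟨⟨⟨⟨hd, hγ⟩, hν⟩, hε⟩, -, -, hM⟩, hs2, hcR, hA₁, hC₀, hC₁, hγ1⟩
    exact ⟨hd, hν, hε, ⟨hγ, hγ1⟩, hM, hA₁, hs2, hcR, hC₀, hC₁⟩
  · rintro ⟨hd, hν, hε, ⟨hγ, hγ1⟩, hM, hA₁, hs2, hcR, hC₀, hC₁⟩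
    exact ⟨⟨⟨⟨⟨hd, hγ⟩, hν⟩, hε⟩, one_pos, isChartOfRecord_stage8OfNumericsDZ F N d n res Efl logz, hM⟩, hs2, hcR, hA₁, hC₀, hC₁, hγ1⟩

/-- The Z-maker is admissible at an admissible dictionary and positive numerics — whatever the letters. [cite: Balaban1988Convergent, (2.10) p.256, (2.28) p.259, (2.34)–(2.39) p.261 (bookkeeping)] -/
theorem admissible_stage12OfNumericsDZ (hd : d.toStage1Params.Admissible) (hn : n.Pos) : (stage12OfNumericsDZ F N d n res Efl logz ζ Rz Zt).Admissible F N :=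
  (admissible_stage12OfNumericsDZ_iff F N d n res Efl logz ζ Rz Zt).mpr ⟨hd, hn⟩

/-! ## §3. BRIDGES: every landed maker is the `(0, 0)` instance of the Z edition (`rfl`) — nothing downstream re-keys -/

/-- **`stage8OfNumericsD = stage8OfNumericsDZ … 0 0`** (`rfl`): the D-maker of record IS the coupling-blind member of the Z family. [cite: Balaban1987RG1, (0.21) p.256 (bookkeeping)] -/
theorem stage8OfNumericsD_eq_DZ : stage8OfNumericsD F N d n res = stage8OfNumericsDZ F N d n res (fun _ _ => 0) (fun _ _ => 0) := rfl

/-- **`stage12OfNumericsD = stage12OfNumericsDZ … 0 0`** (`rfl`). [cite: Balaban1988Convergent, (2.10) p.256 (bookkeeping)] -/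
theorem stage12OfNumericsD_eq_DZ :
    stage12OfNumericsD F N d n res ζ Rz Zt = stage12OfNumericsDZ F N d n res (fun _ _ => 0) (fun _ _ => 0) ζ Rz Zt := rfl

/-- **The landed Stage-8 maker at the dictionary of record IS the Z-maker at `(stage3OfRecord₁₂, 0, 0)`** (`rfl`). [cite: Balaban1987RG1, (0.21) p.256 (bookkeeping)] -/
theorem stage8OfNumerics_eq_DZ (n : Stage12Numerics) (res : Residual₅ F N) :
    stage8OfNumerics F N n res = stage8OfNumericsDZ F N stage3OfRecord₁₂ n res (fun _ _ => 0) (fun _ _ => 0) := rfl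

/-- **The landed Stage-12 maker IS the Z-maker at `(stage3OfRecord₁₂, 0, 0)`** (`rfl`). [cite: Balaban1988Convergent, (2.10) p.256 (bookkeeping)] -/
theorem stage12OfNumerics_eq_DZ :
    stage12OfNumerics F N n res ζ Rz Zt = stage12OfNumericsDZ F N stage3OfRecord₁₂ n res (fun _ _ => 0) (fun _ _ => 0) ζ Rz Zt := rfl

end MakerDZ

/-! ## §4. The family-block-size witness WITH THE LETTERS `θ₀ᶠᵃᵐ·ᴸ·ᶻ(ε₀; Efl, logz) = theta12OfFamilyLZ F N ε₀ ζ Rz Zt Efl logz` -/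

section ThetaLZ

variable (F : T4Family) (N : ℕ) [NeZero N] (ε₀ : ℝ)
variable (ζ : ZetaOfRecord F N (numerics7OfFamily ε₀) 1) (Rz : (K : ℕ) → Sect2.Residual (F.P K) (MatA N)) (Zt : (K : ℕ) → TkResidualW F N (FluctV N) K)
variable (Efl logz : B12.RunParams → ℕ → ℝ)

/-- **THE STAGE-12 WITNESS OF THE FAMILY WITH THE FAMILY'S BLOCK SIZE AND THE FLUCTUATION LETTERS** `θ₀ᶠᵃᵐ·ᴸ·ᶻ(ε₀; Efl, logz)`: `theta12OfFamilyL` (K0a g3) with `Efl`, `logz` as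
arguments — the Z-maker at the dictionary OF THE FAMILY `stage3OfFamily F`, the family numerics `stage12NumericsOfFamily ε₀`, the degenerate Stage-5 residual, the residual
objects `ζ`, `Rz`, `Zt`. [cite: Balaban1987RG1, (0.1) p.251, (0.21) p.256, (1.12)–(1.16) p.262; Balaban1988Convergent, (1.15) p.249, (2.4) p.255, (2.10) p.256, (3.16) p.268; Balaban1989LargeFieldII, (0.15) p.360 (parameter dictionary; bookkeeping witness)] -/
def theta12OfFamilyLZ : Stage12Params F N :=
  stage12OfNumericsDZ F N (stage3OfFamily F) (stage12NumericsOfFamily ε₀) (residual5OfRecord₁₂ F N) Efl logz ζ Rz Zt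

/-- **`theta12OfFamilyL = theta12OfFamilyLZ … 0 0`** (`rfl`): the landed witness IS the coupling-blind member. [cite: Balaban1987RG1, (0.21) p.256 (bookkeeping)] -/
theorem theta12OfFamilyL_eq_LZ : theta12OfFamilyL F N ε₀ ζ Rz Zt = theta12OfFamilyLZ F N ε₀ ζ Rz Zt (fun _ _ => 0) (fun _ _ => 0) := rfl

/-- FACE (`rfl`): `Efl`. [cite: Balaban1988Convergent, (1.15) p.249 (bookkeeping)] -/
theorem theta12OfFamilyLZ_Efl : (theta12OfFamilyLZ F N ε₀ ζ Rz Zt Efl logz).Efl = Efl := rfl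

/-- FACE (`rfl`): `logz`. [cite: Balaban1989LargeFieldII, (0.15) p.360 (bookkeeping)] -/
theorem theta12OfFamilyLZ_logz : (theta12OfFamilyLZ F N ε₀ ζ Rz Zt Efl logz).logz = logz := rfl

/-- `θ₀ᶠᵃᵐ·ᴸ·ᶻ.L = F.L` (`rfl`). [cite: Balaban1987RG1, (0.1) p.251 (bookkeeping)] -/
theorem theta12OfFamilyLZ_L : (theta12OfFamilyLZ F N ε₀ ζ Rz Zt Efl logz).L = F.L := rfl

/-- `θ₀ᶠᵃᵐ·ᴸ·ᶻ.ℓ₆ = F.L − 1` (`rfl`). [cite: Balaban1987RG1, (0.1) p.251 (bookkeeping)] -/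
theorem theta12OfFamilyLZ_ℓ₆ : (theta12OfFamilyLZ F N ε₀ ζ Rz Zt Efl logz).ℓ₆ = F.L - 1 := rfl

/-- `θ₀ᶠᵃᵐ·ᴸ·ᶻ.ℓ₆ + 1 = F.L`. [cite: Balaban1987RG1, (0.1) p.251 (bookkeeping)] -/
theorem theta12OfFamilyLZ_ℓ₆_succ : (theta12OfFamilyLZ F N ε₀ ζ Rz Zt Efl logz).ℓ₆ + 1 = F.L := stage3OfFamily_ℓ₆_succ F

/-- N10's Lemma-3 level-T binder `8 ≤ θ.ℓ₆ + 1` at the Z witness. [cite: Balaban1987RG1, (0.1) p.251; Balaban1988RG2Cluster, (2.36) p.19] -/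
theorem eight_le_L_theta12OfFamilyLZ : 8 ≤ (theta12OfFamilyLZ F N ε₀ ζ Rz Zt Efl logz).ℓ₆ + 1 := eight_le_L_stage3OfFamily F

/-- `12 ≤ θ.ℓ₆ + 1` at the Z witness. [cite: Balaban1987RG1, (0.1) p.251 (bookkeeping)] -/
theorem twelve_le_L_theta12OfFamilyLZ : 12 ≤ (theta12OfFamilyLZ F N ε₀ ζ Rz Zt Efl logz).ℓ₆ + 1 := twelve_le_L_stage3OfFamily F

/-- FACE (`rfl`): Stage-7 numerics of the family. [cite: Balaban1988Convergent, (2.4) p.255 (bookkeeping)] -/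
theorem theta12OfFamilyLZ_ν : (theta12OfFamilyLZ F N ε₀ ζ Rz Zt Efl logz).ν = numerics7OfFamily ε₀ := rfl

/-- FACE (`rfl`): window `½`. [cite: Balaban1987RG1, Thm 1 p.259 (bookkeeping)] -/
theorem theta12OfFamilyLZ_γ : (theta12OfFamilyLZ F N ε₀ ζ Rz Zt Efl logz).γ = 1 / 2 := rfl

/-- FACE (`rfl`): `A₁ = 1`. [cite: Balaban1988Convergent, (3.16) p.268 (bookkeeping)] -/
theorem theta12OfFamilyLZ_A₁ : (theta12OfFamilyLZ F N ε₀ ζ Rz Zt Efl logz).A₁ = 1 := rfl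

/-- FACE (`rfl`): `τ9.M = 1`. [cite: Balaban1989LargeFieldI, (0.3) p.176 (bookkeeping)] -/
theorem theta12OfFamilyLZ_τ9_M : (theta12OfFamilyLZ F N ε₀ ζ Rz Zt Efl logz).τ9.M = 1 := rfl

/-- FACE (`rfl`): §2 numerics of the family. [cite: Balaban1988Convergent, (2.28) p.259 (bookkeeping)] -/
theorem theta12OfFamilyLZ_s2 : (theta12OfFamilyLZ F N ε₀ ζ Rz Zt Efl logz).s2 = sect2NumericsOfFamily := rfl

/-- FACE (`rfl`): `κ = 2·10⁴`. [cite: Balaban1987RG1, (1.18) p.263 (bookkeeping numeral)] -/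
theorem theta12OfFamilyLZ_κ : (theta12OfFamilyLZ F N ε₀ ζ Rz Zt Efl logz).s2.lf.κ = 20000 := rfl

/-- FACE (`rfl`): `ζ`. [cite: Balaban1988Convergent, (3.16) p.268 (bookkeeping)] -/
theorem theta12OfFamilyLZ_ζ : (theta12OfFamilyLZ F N ε₀ ζ Rz Zt Efl logz).ζ = ζ := rfl

/-- FACE (`rfl`): `Rz`. [cite: Balaban1988Convergent, (2.21) p.258 (bookkeeping)] -/
theorem theta12OfFamilyLZ_Rz : (theta12OfFamilyLZ F N ε₀ ζ Rz Zt Efl logz).Rz = Rz := rfl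

/-- FACE (`rfl`): `Zt`. [cite: Balaban1988Convergent, (3.20) p.269 (bookkeeping)] -/
theorem theta12OfFamilyLZ_Zt : (theta12OfFamilyLZ F N ε₀ ζ Rz Zt Efl logz).Zt = Zt := rfl

/-- FACE (`rfl`): the identity `p–p′` selector. [cite: Balaban1989LargeFieldI, (0.3) p.176 (bookkeeping)] -/
theorem theta12OfFamilyLZ_ppSel : (theta12OfFamilyLZ F N ε₀ ζ Rz Zt Efl logz).ppSel = ppSelIdOfRecord F (numerics7OfFamily ε₀) 1 := rfl

variable {ε₀} in
/-- **`θ₀ᶠᵃᵐ·ᴸ·ᶻ(ε₀; Efl, logz)` IS ADMISSIBLE at every positive threshold — WHATEVER THE LETTERS.** [cite: Balaban1987RG1, (0.21) p.256, (1.12) p.262, (1.20)–(1.21) p.264; Balaban1988Convergent, (2.10) p.256, (2.28) p.259, (2.34)–(2.39) p.261, (3.4) p.265 (bookkeeping witness)] -/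
theorem admissible_theta12OfFamilyLZ (hε : 0 < ε₀) : (theta12OfFamilyLZ F N ε₀ ζ Rz Zt Efl logz).Admissible F N :=
  admissible_stage12OfNumericsDZ F N (stage3OfFamily F) (stage12NumericsOfFamily ε₀) (residual5OfRecord₁₂ F N) Efl logz ζ Rz Zt (admissible_stage3OfFamily F)
    (stage12NumericsOfFamily_pos hε)

/-- **AT K0b's RESIDUALS OF RECORD `θ₀ᶠᵃᵐ·ᴸ·ᶻ` CARRIES THEM** (`⟨rfl, rfl, rfl⟩` — `HasResidualsOfRecord` reads `ζ`, `Rz`, `Zt` only, never the fluctuation letters). [cite: Balaban1988Convergent, (3.16) p.268, (2.21) p.258, (3.20) p.269 (bookkeeping)] -/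
theorem hasResidualsOfRecord_theta12OfFamilyLZ :
    (theta12OfFamilyLZ F N ε₀ (zeta316OfRecord F N (numerics7OfFamily ε₀) 1 1) (RzOfRecord F N) (ZtOfRecord F N) Efl logz).HasResidualsOfRecord F N :=
  ⟨rfl, rfl, rfl⟩

/-- Row N1 AT `θ₀ᶠᵃᵐ·ᴸ·ᶻ`: the (D4) `tree` numeral `128·log 162 ≤ κ`. [cite: Balaban1987RG1, (0.25)–(0.26) p.257; Balaban1988RG2Cluster, (1.26) p.8] -/
theorem kp_tree_theta12OfFamilyLZ : 128 * Real.log 162 ≤ (theta12OfFamilyLZ F N ε₀ ζ Rz Zt Efl logz).s2.lf.κ :=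
  kp_tree_lfConstsOfFamily

/-- Row N1 AT `θ₀ᶠᵃᵐ·ᴸ·ᶻ`: N10's rate threshold `2·10⁴ ≤ κ`. [cite: Balaban1987RG1, (1.18) p.263 (bookkeeping numeral)] -/
theorem kp_n10_theta12OfFamilyLZ : (2 * 10 ^ 4 : ℝ) ≤ (theta12OfFamilyLZ F N ε₀ ζ Rz Zt Efl logz).s2.lf.κ :=
  kp_n10_lfConstsOfFamily

/-- Row N1 AT `θ₀ᶠᵃᵐ·ᴸ·ᶻ`: the (D4) `large` numeral at the family's block size. [cite: Balaban1987RG1, (0.25)–(0.26) p.257; Balaban1988RG2Cluster, p.21 (after (2.39))] -/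
theorem kp_large_theta12OfFamilyLZ :
    10 * (64 * Real.log 162 + 1) ≤
      (((((theta12OfFamilyLZ F N ε₀ ζ Rz Zt Efl logz).ℓ₆ + 1 : ℕ) : ℝ)) / 2 - 1) * (theta12OfFamilyLZ F N ε₀ ζ Rz Zt Efl logz).s2.lf.κ := by
  rw [theta12OfFamilyLZ_ℓ₆_succ, theta12OfFamilyLZ_s2, sect2NumericsOfFamily_lf]
  have h3 : 3 ≤ F.L := by have := F.hL11; omega
  exact kp_large_lfConstsOfFamily_of_three_le h3

end ThetaLZ

end Literature.MathematicalPhysics.QuantumFieldTheory.Balaban1983to89.Node00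

end
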